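import Literature.Analysis.FluidPDE.ElgindiWordCoercivity
import HarnessLib

/-!
# `𝓗ᵏ` coercivity of Elgindi's operator `𝓛_Γ^T` ([Elgindi2021] Proposition 6.13;
[ElgindiGhoulMasmoudi2021] Proposition 3.2)

Topic `Literature/Analysis/FluidPDE`. Support file (definitions with bodies and one structure,
everything proved; no named facts) on the proof path of the named fact
`Literature.Analysis.FluidPDE.Elgindi.ElgindiGhoulMasmoudi2021_stabilityCore`
(`ElgindiStabilityDecomposition.lean`). T. M. Elgindi, Ann. of Math. 194 (2021) =
arXiv:1904.04795, §6.3: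

> "**Proposition 6.13.** Fix `α < 10⁻¹⁴` and `k ∈ ℕ`. Then, there exists `c_k > 0` so that for all
> `f ∈ 𝓗ᵏ` we have: `(𝓛_Γ^T(f), f)_{𝓗ᵏ} ≥ c_k|f|²_{𝓗²}`" [sic; `𝓗ᵏ`], with the inner product defined in
> the proof by `(f,g)_{𝓗ᵏ} = (f,g)_{𝓗^{k−1}} + c_{1,k}(D_θf, D_θg)_{𝓗^{k−1}} + c_{2,k}(D_zf, D_zg)_{𝓗^{k−1}}`,
> "where `c_{1,k}, c_{2,k}` will be chosen depending on `k` only",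

and Elgindi–Ghoul–Masmoudi 2021, arXiv:1910.14071, §3.1:

> "**Proposition 3.2.** There exists an inner-product on `𝓗ᵏ` that gives a norm equivalent to the
> `𝓗ᵏ` norm so that `(𝓛^T_{F_*}f, f)_{𝓗ᵏ} ≥ |f|²_{𝓗ᵏ}` … whenever `f ∈ 𝓗ᵏ` and `L₁₂(f)(0) = 0`.
> Proof. To do this, we proceed by induction …"

**Vendored form** (`hkCoercivity`): for every `K` there are positive weights `λ_w` and scales
`Λ_w ≥ 1` on the words `w = (i, j)` with `i + j ≤ K`, and `c > 0`, such that for all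
`0 < α ≤ 10⁻¹⁴` and all smooth test functions `f` (compact support inside the open strip,
`L₁₂(f)(0) = 0`): `c·Σ_{i+j≤K} bQ(D_θ^iD_z^jf) ≤ Σ_{i+j≤K} λ_{ij}·blockΛ α Λ_{ij} (D_θ^iD_z^j𝓛_Γ^Tf)(D_θ^iD_z^jf)`;
the right-hand side is the value at `(𝓛_Γ^Tf, f)` of the symmetric bilinear form
`(F, G) ↦ Σ λ_{ij} blockΛ α Λ_{ij} (D_θ^iD_z^jF)(D_θ^iD_z^jG)` (`hkForm`), an inner product of the
recursive shape of the printed proofs (with `K = k − 1` this is the `𝓗ᵏ` statement: the words of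
order `≤ k − 1` of the block, which carries one more derivative), and the left-hand side dominates
the `𝓗ᵏ` norm of the tree (`ElgindiWeightedSpaces.eHkNormSq`, next file). The induction runs over
the words ordered by total order and, within an order, by the number of `z`-derivatives
(`CoercivityData.step`), exactly as in [EGM] ("induction on `j`"), each step being `wordCoercivity`.
-/

noncomputable section

open MeasureTheory Set Function Real Filter Finset
open _root_.Topology

namespace Literature.Analysis.FluidPDE

namespace Elgindi

/-! ### Word sets and the scaled block quantity -/

/-- The words of total order `< m`, together with those of order `m` having at most `r`
`z`-derivatives. [cite: ElgindiGhoulMasmoudi2021, §3.1 proof of Proposition 3.2 ("we will be done by induction on j") (p. 10 of arXiv:1910.14071)] -/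
def WSet (m r : ℕ) : Finset (ℕ × ℕ) :=
  ((range (m + 1)) ×ˢ (range (m + 1))).filter fun w => w.1 + w.2 < m ∨ (w.1 + w.2 = m ∧ w.2 ≤ r)

/-- Membership in `WSet`. [folklore] -/
theorem mem_WSet {m r : ℕ} {w : ℕ × ℕ} : w ∈ WSet m r ↔ w.1 + w.2 < m ∨ (w.1 + w.2 = m ∧ w.2 ≤ r) := by
  unfold WSet
  rw [Finset.mem_filter, Finset.mem_product, Finset.mem_range, Finset.mem_range]
  constructor
  · exact fun h => h.2
  · intro h
    refine ⟨⟨?_, ?_⟩, h⟩ <;> rcases h with h | ⟨h, _⟩ <;> omega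

/-- The scaled block quantity `N_Λ(g) = sqW_η(D_zg) + Λ(sqW_η(g) + sqW_1(g) + sqW_γ(D_θg))`. [folklore] -/
def Nq (α Λ : ℝ) (g : ℝ → ℝ → ℝ) : ℝ :=
  sqW wEta (Dz g) + Λ * (sqW wEta g + sqW (fun _ => 1) g + sqW (wGam α) (Dθ g))

/-- `bQ ≤ N_Λ` for `Λ ≥ 1`. [folklore] -/
theorem bQ_le_Nq {α Λ : ℝ} (hΛ : 1 ≤ Λ) (g : ℝ → ℝ → ℝ) : bQ α g ≤ Nq α Λ g := by
  rw [bQ_def, Nq]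
  have h2 := sqW_nonneg isWeight_wEta g
  have h3 := sqW_nonneg isWeight_one g
  have h4 := sqW_nonneg (isWeight_wGam α) (Dθ g)
  nlinarith

/-- `0 ≤ N_Λ` for `Λ ≥ 0`. [folklore] -/
theorem Nq_nonneg {α Λ : ℝ} (hΛ : 0 ≤ Λ) (g : ℝ → ℝ → ℝ) : 0 ≤ Nq α Λ g := by
  rw [Nq]
  have h1 := sqW_nonneg isWeight_wEta (Dz g)
  have h2 := sqW_nonneg isWeight_wEta g
  have h3 := sqW_nonneg isWeight_one g
  have h4 := sqW_nonneg (isWeight_wGam α) (Dθ g)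
  positivity

/-! ### The inductive data -/

/-- **Coercivity data on a set of words**: weights `λ_w > 0` (with a uniform positive lower bound),
scales `Λ_w ≥ 1` and a constant `0 < c ≤ 1` such that `c·Σ_{w∈S} λ_w N_{Λ_w}(D^wf) ≤
Σ_{w∈S} λ_w blockΛ α Λ_w (D^w𝓛_Γ^Tf)(D^wf)` for all admissible `α` and test functions `f`. [cite: Elgindi2021, §6.3 proof of Proposition 6.13 (p. 18 of arXiv:1904.04795)] -/
structure CoercivityData (S : Finset (ℕ × ℕ)) where
  /-- the weights -/
  lam : ℕ × ℕ → ℝ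
  /-- the scales -/
  Lam : ℕ × ℕ → ℝ
  /-- the coercivity constant -/
  c : ℝ
  /-- a uniform lower bound of the weights -/
  lamMin : ℝ
  c_pos : 0 < c
  c_le_one : c ≤ 1
  lamMin_pos : 0 < lamMin
  lamMin_le : ∀ w, lamMin ≤ lam w
  Lam_ge : ∀ w, 1 ≤ Lam w
  ineq : ∀ α : ℝ, 0 < α → α ≤ 1 / 10 ^ 14 → ∀ f : ℝ → ℝ → ℝ, (∀ n : ℕ, ContDiff ℝ n (uncurry f)) →
    HasCompactSupport (uncurry f) → tsupport (uncurry f) ⊆ strip → L12 f 0 = 0 →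
      c * ∑ w ∈ S, lam w * Nq α (Lam w) (word w.1 w.2 f) ≤
        ∑ w ∈ S, lam w * blockΛ α (Lam w) (Dθ^[w.1] (Dz^[w.2] (opLΓT α f))) (word w.1 w.2 f)

/-- **The base word**: coercivity data on `{(0,0)}` (Corollary 6.11 in `Λ`-form with `Λ = 1`). [cite: Elgindi2021, §6.2 Corollary 6.11 (p. 17 of arXiv:1904.04795)] -/
def CoercivityData.base : CoercivityData (WSet 0 0) where
  lam := fun _ => 1
  Lam := fun _ => 1
  c := 1
  lamMin := 1
  c_pos := one_pos
  c_le_one := le_rfl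
  lamMin_pos := one_pos
  lamMin_le := fun _ => le_rfl
  Lam_ge := fun _ => le_rfl
  ineq := by
    intro α hα hα14 f hf hs hsub hL0
    have hS : WSet 0 0 = {(0, 0)} := by
      ext w
      rw [mem_WSet, Finset.mem_singleton, Prod.ext_iff]
      omega
    rw [hS, Finset.sum_singleton, Finset.sum_singleton, one_mul, one_mul, one_mul]
    have h := baseBlockΛ hα hα14 le_rfl (hf 3) hs hsub hL0
    simp only [Nq, word_def, Function.iterate_zero, id_eq, one_mul] at h ⊢
    have h2 := sqW_nonneg isWeight_wEta f
    have h3 := sqW_nonneg isWeight_one f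
    have h4 := sqW_nonneg (isWeight_wGam α) (Dθ f)
    linarith

/-- **The inductive step**: adding a word `(i, j)` (`i + j ≥ 1`, not in `S`) whose two error terms
are dominated by the block quantities of the words of `S`. [cite: Elgindi2021, §6.3 proof of Proposition 6.13 ("we now choose c_{1,k} so that c_{1,k}C̄_k = ½c²_{k−1} … choosing c_{2,k} so that c_{2,k}C̄_k = ⅛c²_{1,k}c²_{k−1}") (p. 18 of arXiv:1904.04795)] -/
theorem CoercivityData.step {S : Finset (ℕ × ℕ)} (D : CoercivityData S) {i j : ℕ} (hij : 1 ≤ i + j)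
    (hw : (i, j) ∉ S)
    (hdump : ∀ α : ℝ, 0 < α → α ≤ 1 / 10 ^ 14 → ∀ f : ℝ → ℝ → ℝ, (∀ n : ℕ, ContDiff ℝ n (uncurry f)) →
      HasCompactSupport (uncurry f) → tsupport (uncurry f) ⊆ strip → L12 f 0 = 0 →
        lowSum α (i + j) f + heavySum α i j f ≤ ∑ w ∈ S, bQ α (word w.1 w.2 f)) :
    Nonempty (CoercivityData (insert (i, j) S)) := by
  classical
  obtain ⟨Λ₀, hΛ₀, C, hC0, hword⟩ := wordCoercivity i j hij
  have hcpos := D.c_pos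
  have hc1 := D.c_le_one
  have hmpos := D.lamMin_pos
  obtain ⟨lam₀, hlam₀pos, hlam₀def⟩ : ∃ lam₀ : ℝ, 0 < lam₀ ∧ lam₀ = D.c * D.lamMin / (2 * (C + 1)) :=
    ⟨_, by positivity, rfl⟩
  have hlam₀le : lam₀ ≤ D.lamMin := by
    rw [hlam₀def, div_le_iff₀ (by positivity)]
    nlinarith
  refine ⟨{
    lam := fun w => if w = (i, j) then lam₀ else D.lam w
    Lam := fun w => if w = (i, j) then Λ₀ else D.Lam w
    c := D.c / 2
    lamMin := lam₀
    c_pos := by positivity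
    c_le_one := by linarith
    lamMin_pos := hlam₀pos
    lamMin_le := fun w => by
      by_cases h : w = (i, j)
      · simp [h]
      · simp only [h, if_false]; exact hlam₀le.trans (D.lamMin_le w)
    Lam_ge := fun w => by
      by_cases h : w = (i, j)
      · simp [h, hΛ₀]
      · simp only [h, if_false]; exact D.Lam_ge w
    ineq := ?_ }⟩
  intro α hα hα14 f hf hs hsub hL0
  have hα' : α ≤ 1 / 200 := hα14.trans (by norm_num)
  rw [Finset.sum_insert hw, Finset.sum_insert hw]
  simp only [if_true]
  have hS1 : ∑ w ∈ S, (if w = (i, j) then lam₀ else D.lam w) * Nq α (if w = (i, j) then Λ₀ else D.Lam w) (word w.1 w.2 f) =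
      ∑ w ∈ S, D.lam w * Nq α (D.Lam w) (word w.1 w.2 f) := by
    refine Finset.sum_congr rfl fun w hwS => ?_
    have : w ≠ (i, j) := fun h => hw (h ▸ hwS)
    simp [this]
  have hS2 : ∑ w ∈ S, (if w = (i, j) then lam₀ else D.lam w) *
        blockΛ α (if w = (i, j) then Λ₀ else D.Lam w) (Dθ^[w.1] (Dz^[w.2] (opLΓT α f))) (word w.1 w.2 f) =
      ∑ w ∈ S, D.lam w * blockΛ α (D.Lam w) (Dθ^[w.1] (Dz^[w.2] (opLΓT α f))) (word w.1 w.2 f) := by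
    refine Finset.sum_congr rfl fun w hwS => ?_
    have : w ≠ (i, j) := fun h => hw (h ▸ hwS)
    simp [this]
  rw [hS1, hS2]
  -- abbreviations
  obtain ⟨SN, hSN0, hSNdef⟩ : ∃ SN : ℝ, 0 ≤ SN ∧ SN = ∑ w ∈ S, D.lam w * Nq α (D.Lam w) (word w.1 w.2 f) :=
    ⟨_, Finset.sum_nonneg fun w _ => mul_nonneg (hmpos.le.trans (D.lamMin_le w))
      (Nq_nonneg (zero_le_one.trans (D.Lam_ge w)) _), rfl⟩
  obtain ⟨N₀, hN₀0, hN₀def⟩ : ∃ N₀ : ℝ, 0 ≤ N₀ ∧ N₀ = Nq α Λ₀ (word i j f) :=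
    ⟨_, Nq_nonneg (zero_le_one.trans hΛ₀) _, rfl⟩
  rw [← hSNdef, ← hN₀def]
  have hold := D.ineq α hα hα14 f hf hs hsub hL0
  rw [← hSNdef] at hold
  have hnew : N₀ ≤ blockΛ α Λ₀ (Dθ^[i] (Dz^[j] (opLΓT α f))) (word i j f) + C * (lowSum α (i + j) f + heavySum α i j f) := by
    rw [hN₀def]; exact hword α hα hα' f hf hs hsub hL0
  have hd := hdump α hα hα14 f hf hs hsub hL0
  have hQ0 : 0 ≤ lowSum α (i + j) f + heavySum α i j f := add_nonneg (lowSum_nonneg _ _ _) (heavySum_nonneg _ _ _ _)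
  -- `Σ_S bQ ≤ SN / lamMin`
  have hbq : ∑ w ∈ S, bQ α (word w.1 w.2 f) ≤ (1 / D.lamMin) * SN := by
    rw [hSNdef, Finset.mul_sum]
    refine Finset.sum_le_sum fun w _ => ?_
    have h1 := bQ_le_Nq (α := α) (D.Lam_ge w) (word w.1 w.2 f)
    have h2 := D.lamMin_le w
    have h3 := Nq_nonneg (α := α) (zero_le_one.trans (D.Lam_ge w)) (word w.1 w.2 f)
    have h4 : 1 ≤ (1 / D.lamMin) * D.lam w := by
      rw [one_div, ← div_eq_inv_mul, one_le_div hmpos]; exact h2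
    calc bQ α (word w.1 w.2 f) ≤ Nq α (D.Lam w) (word w.1 w.2 f) := h1
      _ = 1 * Nq α (D.Lam w) (word w.1 w.2 f) := (one_mul _).symm
      _ ≤ ((1 / D.lamMin) * D.lam w) * Nq α (D.Lam w) (word w.1 w.2 f) := mul_le_mul_of_nonneg_right h4 h3
      _ = (1 / D.lamMin) * (D.lam w * Nq α (D.Lam w) (word w.1 w.2 f)) := by ring
  -- the error of the new word in terms of `SN`
  have k1 : lam₀ * (C * (lowSum α (i + j) f + heavySum α i j f)) ≤ D.c / 2 * SN := by
    have h1 : lam₀ * (C * (lowSum α (i + j) f + heavySum α i j f)) ≤ lam₀ * (C * ((1 / D.lamMin) * SN)) :=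
      mul_le_mul_of_nonneg_left (mul_le_mul_of_nonneg_left (hd.trans hbq) hC0) hlam₀pos.le
    have h2 : lam₀ * (C * ((1 / D.lamMin) * SN)) = (D.c / 2) * (C / (C + 1)) * SN := by
      rw [hlam₀def]; field_simp
    have h3 : (D.c / 2) * (C / (C + 1)) * SN ≤ D.c / 2 * SN := by
      have : C / (C + 1) ≤ 1 := by rw [div_le_one (by positivity)]; linarith
      have h0 : 0 ≤ D.c / 2 * SN := by positivity
      nlinarith
    linarith
  have hnewl := mul_le_mul_of_nonneg_left hnew hlam₀pos.le
  have k2 : D.c / 2 * (lam₀ * N₀) ≤ lam₀ * N₀ := mul_le_of_le_one_left (by positivity) (by linarith)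
  have e1 : D.c * SN = 2 * (D.c / 2 * SN) := by ring
  have e2 : D.c / 2 * (lam₀ * N₀ + SN) = D.c / 2 * (lam₀ * N₀) + D.c / 2 * SN := by ring
  have e3 : lam₀ * (blockΛ α Λ₀ (Dθ^[i] (Dz^[j] (opLΓT α f))) (word i j f) + C * (lowSum α (i + j) f + heavySum α i j f)) =
      lam₀ * blockΛ α Λ₀ (Dθ^[i] (Dz^[j] (opLΓT α f))) (word i j f) + lam₀ * (C * (lowSum α (i + j) f + heavySum α i j f)) := by
    ring
  rw [e3] at hnewl
  rw [e2]
  linarith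

/-! ### The error terms of a word inside the word sets -/

/-- `LOW_n(f)` as a sum over the word pairs of order `< n`. [folklore] -/
theorem lowSum_eq_sum_filter (α : ℝ) (n : ℕ) (f : ℝ → ℝ → ℝ) :
    lowSum α n f = ∑ w ∈ ((range n) ×ˢ (range n)).filter (fun w => w.1 + w.2 < n), bQ α (word w.1 w.2 f) := by
  unfold lowSum
  rw [Finset.sum_filter, Finset.sum_product]

/-- `LOW_n(f) ≤ Σ_{w∈S} bQ(D^wf)` whenever `S` contains all words of order `< n` together with an extra
word `w₀ ∉ {order < n}`, in which case also `+ bQ(D^{w₀}f)` fits. [folklore] -/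
theorem lowSum_add_le_sum {α : ℝ} {n : ℕ} {S : Finset (ℕ × ℕ)} {w₀ : ℕ × ℕ} (hw₀ : w₀ ∈ S) (hw₀n : n ≤ w₀.1 + w₀.2)
    (hS : ∀ w : ℕ × ℕ, w.1 + w.2 < n → w ∈ S) (f : ℝ → ℝ → ℝ) :
    lowSum α n f + bQ α (word w₀.1 w₀.2 f) ≤ ∑ w ∈ S, bQ α (word w.1 w.2 f) := by
  classical
  rw [lowSum_eq_sum_filter]
  set F : Finset (ℕ × ℕ) := ((range n) ×ˢ (range n)).filter (fun w => w.1 + w.2 < n) with hF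
  have hw₀F : w₀ ∉ F := by
    rw [hF, Finset.mem_filter]; intro h; omega
  have hsub : insert w₀ F ⊆ S := by
    intro w hw
    rcases Finset.mem_insert.1 hw with rfl | hw
    · exact hw₀
    · rw [hF, Finset.mem_filter] at hw; exact hS w hw.2
  have h := Finset.sum_le_sum_of_subset_of_nonneg hsub (f := fun w => bQ α (word w.1 w.2 f))
    (fun w _ _ => bQ_nonneg α _)
  rw [Finset.sum_insert hw₀F] at h
  linarith

/-- `LOW_n(f) ≤ Σ_{w∈S} bQ(D^wf)` whenever `S` contains all words of order `< n`. [folklore] -/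
theorem lowSum_le_sum {α : ℝ} {n : ℕ} {S : Finset (ℕ × ℕ)} (hS : ∀ w : ℕ × ℕ, w.1 + w.2 < n → w ∈ S) (f : ℝ → ℝ → ℝ) :
    lowSum α n f ≤ ∑ w ∈ S, bQ α (word w.1 w.2 f) := by
  classical
  rw [lowSum_eq_sum_filter]
  refine Finset.sum_le_sum_of_subset_of_nonneg (fun w hw => ?_) fun w _ _ => bQ_nonneg α _
  rw [Finset.mem_filter] at hw
  exact hS w hw.2

/-- `HEAVY_{i,j}(f) ≤ bQ(D_θ^{i+1}D_z^{j−1}f)`. [folklore] -/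
theorem heavySum_le_bQ (α : ℝ) (i j : ℕ) (f : ℝ → ℝ → ℝ) : heavySum α i j f ≤ bQ α (word (i + 1) (j - 1) f) := by
  unfold heavySum
  split_ifs
  · exact bQ_nonneg α _
  · rw [bQ_def]
    have := sqW_nonneg isWeight_wEta (Dz (word (i + 1) (j - 1) f))
    linarith

/-! ### The induction over the word sets -/

/-- A word of order `≥ m` is outside `WSet m r` unless it has order `m` and at most `r` `z`-derivatives. [folklore] -/
theorem not_mem_WSet {m r a b : ℕ} (h : m ≤ a + b) (h' : a + b = m → r < b) : (a, b) ∉ WSet m r := by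
  intro hm
  rw [mem_WSet] at hm
  simp only at hm
  omega

/-- `WSet m m ⊆ WSet (m+1) 0` as the insertion of the pure-`θ` word `(m+1, 0)`. [folklore] -/
theorem insert_WSet_succ (m : ℕ) : insert (m + 1, 0) (WSet m m) = WSet (m + 1) 0 := by
  ext w
  rw [Finset.mem_insert, mem_WSet, mem_WSet, Prod.ext_iff]
  simp only
  omega

/-- Inside order `m`: inserting the word `(m − (r+1), r+1)`. [folklore] -/
theorem insert_WSet_step {m r : ℕ} (hr : r + 1 ≤ m) : insert (m - (r + 1), r + 1) (WSet m r) = WSet m (r + 1) := by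
  ext w
  rw [Finset.mem_insert, mem_WSet, mem_WSet, Prod.ext_iff]
  simp only
  omega

/-- **Coercivity data on all the word sets** (the double induction of [EGM] §3.1 / [Elgindi2021]
§6.3). [cite: Elgindi2021, §6.3 proof of Proposition 6.13 (p. 18 of arXiv:1904.04795); ElgindiGhoulMasmoudi2021, §3.1 proof of Proposition 3.2 (p. 10 of arXiv:1910.14071)] -/
theorem nonempty_coercivityData : ∀ m r : ℕ, r ≤ m → Nonempty (CoercivityData (WSet m r)) := by
  intro m
  induction m with
  | zero =>
    intro r hr
    rw [Nat.le_zero.1 hr]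
    exact ⟨CoercivityData.base⟩
  | succ m ih =>
    -- first the pure-`θ` word of order `m+1`, then the others by increasing number of `z`-derivatives
    have h0 : Nonempty (CoercivityData (WSet (m + 1) 0)) := by
      obtain ⟨D⟩ := ih m le_rfl
      rw [← insert_WSet_succ]
      refine D.step (i := m + 1) (j := 0) (by omega) (not_mem_WSet (by omega) (by omega)) ?_
      intro α _ _ f _ _ _ _
      have h1 : lowSum α (m + 1 + 0) f ≤ ∑ w ∈ WSet m m, bQ α (word w.1 w.2 f) :=
        lowSum_le_sum (fun w hw => by rw [mem_WSet]; omega) f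
      have h2 : heavySum α (m + 1) 0 f = 0 := by unfold heavySum; simp
      linarith
    intro r
    induction r with
    | zero => exact fun _ => h0
    | succ r ihr =>
      intro hr
      obtain ⟨D⟩ := ihr (by omega)
      rw [← insert_WSet_step hr]
      refine D.step (i := m + 1 - (r + 1)) (j := r + 1) (by omega)
        (not_mem_WSet (by omega) (by omega)) ?_
      intro α _ _ f _ _ _ _
      have e : m + 1 - (r + 1) + (r + 1) = m + 1 := by omega
      rw [e]
      have hheavy := heavySum_le_bQ α (m + 1 - (r + 1)) (r + 1) f
      have e2 : m + 1 - (r + 1) + 1 = m + 1 - r := by omega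
      have e3 : r + 1 - 1 = r := by omega
      rw [e2, e3] at hheavy
      have h := lowSum_add_le_sum (α := α) (n := m + 1) (S := WSet (m + 1) r) (w₀ := (m + 1 - r, r))
        (by rw [mem_WSet]; simp; omega) (by simp; omega) (fun w hw => by rw [mem_WSet]; omega) f
      simp only at h
      linarith

/-! ### The `𝓗ᵏ` coercivity statement -/

/-- **The bilinear form** `(F, G) ↦ Σ_{i+j≤K} λ_{ij}·blockΛ α Λ_{ij} (D_θ^iD_z^jF)(D_θ^iD_z^jG)`: an
inner product of the recursive shape of the printed proofs on the words of order `≤ K`. [cite: Elgindi2021, §6.3 proof of Proposition 6.13 (the definition of (f,g)_{𝓗ᵏ}) (p. 18 of arXiv:1904.04795)] -/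
def hkForm (α : ℝ) (K : ℕ) (lam Lam : ℕ × ℕ → ℝ) (F G : ℝ → ℝ → ℝ) : ℝ :=
  ∑ w ∈ WSet K K, lam w * blockΛ α (Lam w) (Dθ^[w.1] (Dz^[w.2] F)) (Dθ^[w.1] (Dz^[w.2] G))

/-- Membership in the full word set of order `≤ K`. [folklore] -/
theorem mem_WSet_self {K : ℕ} {w : ℕ × ℕ} : w ∈ WSet K K ↔ w.1 + w.2 ≤ K := by
  rw [mem_WSet]; omega

/-- **`𝓗ᵏ` coercivity of `𝓛_Γ^T` (Elgindi 2021, Proposition 6.13; Elgindi–Ghoul–Masmoudi 2021,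
Proposition 3.2), vendored form**: for every `K` there are weights `λ_w > 0`, scales `Λ_w ≥ 1`
(`w = (i,j)`, `i + j ≤ K`) and `c > 0` such that for all `0 < α ≤ 10⁻¹⁴` and all smooth test
functions `f` compactly supported inside the open strip with `L₁₂(f)(0) = 0`,
`c·Σ_{i+j≤K} bQ(D_θ^iD_z^jf) ≤ hkForm α K λ Λ (𝓛_Γ^Tf) f`. [cite: Elgindi2021, §6.3 Proposition 6.13 (p. 18 of arXiv:1904.04795); ElgindiGhoulMasmoudi2021, §3.1 Proposition 3.2 (p. 10 of arXiv:1910.14071)] -/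
theorem hkCoercivity (K : ℕ) : ∃ lam Lam : ℕ × ℕ → ℝ, ∃ c : ℝ, 0 < c ∧ (∀ w, 0 < lam w) ∧ (∀ w, 1 ≤ Lam w) ∧
    ∀ α : ℝ, 0 < α → α ≤ 1 / 10 ^ 14 → ∀ f : ℝ → ℝ → ℝ, (∀ n : ℕ, ContDiff ℝ n (uncurry f)) →
    HasCompactSupport (uncurry f) → tsupport (uncurry f) ⊆ strip → L12 f 0 = 0 →
      c * ∑ w ∈ WSet K K, bQ α (word w.1 w.2 f) ≤ hkForm α K lam Lam (opLΓT α f) f := by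
  obtain ⟨D⟩ := nonempty_coercivityData K K le_rfl
  refine ⟨D.lam, D.Lam, D.c * D.lamMin, mul_pos D.c_pos D.lamMin_pos, fun w => D.lamMin_pos.trans_le (D.lamMin_le w),
    D.Lam_ge, ?_⟩
  intro α hα hα14 f hf hs hsub hL0
  have h := D.ineq α hα hα14 f hf hs hsub hL0
  have h1 : D.lamMin * ∑ w ∈ WSet K K, bQ α (word w.1 w.2 f) ≤ ∑ w ∈ WSet K K, D.lam w * Nq α (D.Lam w) (word w.1 w.2 f) := by
    rw [Finset.mul_sum]
    refine Finset.sum_le_sum fun w _ => ?_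
    exact mul_le_mul (D.lamMin_le w) (bQ_le_Nq (D.Lam_ge w) _) (bQ_nonneg α _) (D.lamMin_pos.le.trans (D.lamMin_le w))
  have h2 := mul_le_mul_of_nonneg_left h1 D.c_pos.le
  unfold hkForm
  simp only [word_def] at h h2 ⊢
  linarith

end Elgindi

end Literature.Analysis.FluidPDE
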